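/-
Copyright (c) 2026 the pub-hodgecm-mathlib formalisation cell (harness21).  Prover seat hodgecm-mathlib-LH4-p03 (g5), 2026-09-02: (α4-S7-model) «MODEL IDENTITY ON `InRegS`»
(LH3-plan (g3) deal 10:09:22Z; (α4) spec-owner LH3-p01 (g4), `ALPHA4-DESIGN.v1.md` (S7)).
-/
import Literature.NumberTheory.Rogawski1990.ArchBouazizStableFamilySlabSmooth   -- ★ p850541 (LH3-p01 (g4)): [C1b] + the factor lemmas `archRH_eq_splitFactor_mul_cptFactor`, `expFactor_eq_splitFactor_mul_cptFactor`, `splitFactor_flipSet`, `contDiff_expFactor`; brings ★ `stOrbFamH`, ★ `stOrbFamH_eq_of_tendsto`, ★ `mem_closure_regS`, ★ `flipSet` API, ★ `archRH_flipSet`, ★ `contDiff_flipSet`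
import HarnessLib

/-!
# The stable orbital family IS its continuous model on `InRegS`: `stOrbFamH = K₀ · E_S · Σ_T I ∘ flipSet T`, for ANY model `(K₀, I)` of `R_S · chartOrbH` on `RegS`;
# the flip law of `E_S` and the `T`-reduction `E_S · (I ∘ flipSet T) = u_T · (E_S · I) ∘ flipSet T` (Shelstad 1979 §4; Bouaziz 1994 §6.2; Varadarajan 1989 §6.4)

Topic `NumberTheory/Rogawski1990`; namespace `Literature.NumberTheory.Rogawski1990`.  THEOREMS ONLY (no `def`, no instance, no axiom, no named fact, no `sorry`; axioms ⊆ {propext,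
Classical.choice, Quot.sound}).  Cell `pub/hodgecm-mathlib` (D-0151), crux H413 = `stmt-HodgeConjecture-24833`; half A line LH3 (closer stub `stub_N9`, DIRECT ROAD
`Cruxes/H413/Lines/F0_P3c_StubN9Direct.lean`), letter L3′ (`BouazizSurjectiveStatement`) forward half, organ (α4) «all-orders transport» — stage **(S7-model)** of LH3-p01 (g4)'s
`ALPHA4-DESIGN.v1.md`: the MODEL IDENTITY on Bouaziz's in-regular set and the `T`-REDUCTION of the stable sum to ONE function composed with the flips.  Author LH4-p03 (g5)
(LH3-plan (g3) deal 2026-09-02T10:09:22Z).  HONEST LABEL: HC_CM is proved only modulo the 7 printed citations (2 remaining named inputs: hLiu418 = stmt-HodgeConjecture-24832,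
h413 = stmt-HodgeConjecture-24833) until rung 0 closes; this file is bookkeeping over ★ `stOrbFamH_eq_of_tendsto` and the coordinate factors, count-neutral, pays no letter by itself.

THE OBJECTS (all ★).  `stOrbFamH L νH fH S = bzExtend S (R_S · stableSum S (chartOrbH L νH S fH))` (★ `ArchBouazizStableFamily`): LITERALLY `R_S(c) · Σ_{T ⊆ univ∖S} chartOrbH (flipSet T c)`
on `RegS S` (★ `stOrbFamH_of_mem_regS`), the limit from `RegS S` on the real walls (★ `stOrbFamH_eq_of_tendsto`), `0` off `InRegS S`.  `R_S = archRH S` (★ `ArchCartanNormalisers`),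
`E_S(c) := Π_w [w ∈ S ? e^{x_w} : 1 − e^{i(c_{w2} − c_{w0})}]` (written out as the explicit product, as in ★ [C1b] and ★ (α4¹) — no definition), sharing its compact factors with `R_S`
(★ `archRH_eq_splitFactor_mul_cptFactor`, ★ `expFactor_eq_splitFactor_mul_cptFactor`).  A MODEL of the chart functional is a pair `(K₀ : ℂ, I : (W → Fin 3 → ℝ) → ℂ)` with
  `hid : ∀ c ∈ RegS S, archRH S c * chartOrbH L νH S fH c = K₀ * E_S c * I c`
— the literal conclusion of ★ (M1b′) `exists_leafMeasure_archRH_mul_chartOrbH_eq_of_isHaarMeasure` (single leaf) AND of ★ (α4¹) p850894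
`exists_placeLeaves_archRH_mul_chartOrbH_eq_integral_integral` (a set of compact places integrated out first); both plug BY NAME (with `(K₀ : ℂ)` the cast of their real `K₀`).

WHAT IS PROVED.
* §1 COORDINATES ONLY (`{W} [Fintype W] [DecidableEq W]`): **`cptFactor_flipSet`**, **`expFactor_flipSet`** (`E_S (flipSet T c) = (Π_{w∈T} −e^{i(c_{w0}−c_{w2})}) · E_S c`, the same unit as
  ★ `archRH_flipSet`), **`archRH_mul_expFactor_flipSet`** (`R_S c · E_S (flipSet T c) = R_S (flipSet T c) · E_S c`), the unit `u_T c := Π_{w∈T} −e^{i(c_{w2}−c_{w0})}`: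
  `flipUnit_mul_flipUnit_eq_one`, `norm_flipUnit_eq_one`, `contDiff_flipUnit`, and the **`T`-REDUCTION `expFactor_mul_apply_flipSet`**: `E_S c · I (flipSet T c) = u_T c · (E_S · I)(flipSet T c)`.
* §2 THE ABSTRACT TRANSFER (any `fH`, any `νH` finite on compacta and right-invariant — NO smoothness, NO [C1b]): **`stOrbFamH_eq_of_continuousOn_of_eqOn_regS`** — if `G` is continuous
  on `InRegS S` and `R_S · stableSum = G` on `RegS S`, then `stOrbFamH = G` on ALL of `InRegS S` (at a real-wall point the family is by definition the limit from `RegS S`, which is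
  dense (★ `mem_closure_regS`) in the open `InRegS S` ⊇ `RegS S`); `EqOn` dress and the jet corollary `iteratedFDeriv_stOrbFamH_eq_of_eqOn_regS` (`InRegS S` is open).
* §3 THE STABLE SUM OF A MODEL: **`archRH_mul_stableSum_chartOrbH_eq_of_model`** — `hid` ⇒ `R_S c · stableSum c = K₀ · E_S c · Σ_T I (flipSet T c)` on `RegS S` (apply `hid` at `flipSet T c
  ∈ RegS S` and cancel the common flip unit of `R_S` and `E_S` — ★ [C1b]'s step (M3), now for an abstract `I`).
* §4 HEAD **`stOrbFamH_eq_model_of_mem_inRegS (hid) (hI : ContinuousOn I (InRegS S)) : ∀ c ∈ InRegS S, stOrbFamH L νH fH S c = K₀ * E_S c * Σ_{T ⊆ univ∖S} I (flipSet T c)`**;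
  `contDiffOn_model_inRegS` (`I` smooth on `InRegS S` ⇒ the model is), `iteratedFDeriv_stOrbFamH_eq_model` (jets of the family = jets of the model on `InRegS S`), and the flip-unit
  form **`stOrbFamH_eq_sum_flipUnit_mul_model_flipSet`**: `stOrbFamH c = K₀ · Σ_T u_T c · (E_S · I)(flipSet T c)` — the stable family is a sum of ONE function `G₀ := E_S · I` composed
  with the `2^{#compact}` flips, times smooth unimodular units ((S7): jet bounds for `stOrbFamH` near a base point reduce to jet bounds for `G₀` near the flipped base points).
NOT HERE: any bound ((S4)∕(S5)∕(S6) of the design), any choice of model (the consumer instantiates `hid` with ★ (M1b′) or ★ (α4¹)), the LOCAL-TO-GLOBAL step (★ p850876).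

## References
* [Shelstad1979] D. Shelstad, *Characters and inner forms of a quasi-split group over ℝ*, Compositio Math. 39 (1979), §4 pp. 22–25 (`Ψ^T_f = R_T Φ^{T,1}_f`, the `𝒟(T)`-sum, (II)).
* [Bouaziz1994IntegralesOrbitales] A. Bouaziz, *Intégrales orbitales sur les groupes de Lie réductifs*, Ann. Sci. ÉNS 27 (1994), §6.2 p. 591 (`T_{in-reg}`, `ψ^{st}`), §3.1 p. 579.
* [Varadarajan1989] V. S. Varadarajan, *An Introduction to Harmonic Analysis on Semisimple Lie Groups* (1989), §6.4 Thm 22–23 (`F_f` extends continuously∕smoothly across the real walls).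
* [Rogawski1990] J. D. Rogawski, *Automorphic Representations of Unitary Groups in Three Variables*, Ann. of Math. Stud. 123 (1990), §4.1 (4.1.1) p. 39, §8.2 pp. 119–122.
-/

set_option autoImplicit false

noncomputable section

open MeasureTheory Measure Filter Topology Set Function NumberField NumberField.InfinitePlace Complex
open Literature.NumberTheory.Automorphic Literature.NumberTheory.Automorphic.UnitaryGroup Literature.NumberTheory.Automorphic.ArchCartan
open scoped ContDiff Classical

namespace Literature.NumberTheory.Rogawski1990

/-! ## §1 Coordinates only: the flip law of `E_S`, the unit `u_T`, the `T`-reduction -/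

section FlipUnit

variable {W : Type*} [Fintype W] [DecidableEq W]

/-- `e^{i(a−b)} · e^{i(b−a)} = 1` on the unit circle, coerced to `ℂ`. [cite: Shelstad1979, §4 p. 23] -/
theorem coe_circleExp_sub_mul_coe_circleExp_sub (a b : ℝ) : (Circle.exp (a - b) : ℂ) * (Circle.exp (b - a) : ℂ) = 1 := by
  rw [← Circle.coe_mul, ← Circle.exp_add, show a - b + (b - a) = 0 by ring, Circle.exp_zero, Circle.coe_one]

/-- **THE COMPACT FACTOR UNDER A SET OF FLIPS**: for `T ⊆ Sᶜ`, `Π_{w∉S} (1 − e^{i(c′_{w2} − c′_{w0})})` at `c′ = flipSet T c` equals `(Π_{w∈T} −e^{i(c_{w0} − c_{w2})}) · Π_{w∉S} (1 − e^{i(c_{w2} − c_{w0})})`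
(at a flipped place `1 − e^{i(θ₀−θ₂)} = −e^{i(θ₀−θ₂)}(1 − e^{i(θ₂−θ₀)})`) — the unit of ★ `archRH_flipSet`. [cite: Shelstad1979, §4 p. 23] -/
theorem cptFactor_flipSet (S T : Finset W) (hT : ∀ w ∈ T, w ∉ S) (c : W → Fin 3 → ℝ) :
    (∏ w, (if w ∈ S then (1 : ℂ) else 1 - (Circle.exp (flipSet T c w 2 - flipSet T c w 0) : ℂ))) =
      (∏ w ∈ T, -(Circle.exp (c w 0 - c w 2) : ℂ)) * ∏ w, (if w ∈ S then (1 : ℂ) else 1 - (Circle.exp (c w 2 - c w 0) : ℂ)) := by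
  have hT' : (∏ w ∈ T, -(Circle.exp (c w 0 - c w 2) : ℂ)) = ∏ w, (if w ∈ T then -(Circle.exp (c w 0 - c w 2) : ℂ) else 1) := by
    rw [Finset.prod_ite_mem, Finset.univ_inter]
  rw [hT', ← Finset.prod_mul_distrib]
  refine Finset.prod_congr rfl fun w _ => ?_
  by_cases hwT : w ∈ T
  · have hwS : w ∉ S := hT w hwT
    rw [if_neg hwS, if_neg hwS, if_pos hwT, flipSet_apply_of_mem hwT]
    simp only [Matrix.cons_val_zero, Matrix.cons_val_two, Matrix.tail_cons, Matrix.head_cons]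
    linear_combination -(coe_circleExp_sub_mul_coe_circleExp_sub (c w 0) (c w 2))
  · rw [if_neg hwT, one_mul, flipSet_apply_of_not_mem hwT]

/-- **THE FLIP LAW OF `E_S`**: `E_S (flipSet T c) = (Π_{w∈T} −e^{i(c_{w0} − c_{w2})}) · E_S c` for `T ⊆ Sᶜ` — `E_S` and `R_S` share their compact factors (★ `expFactor_eq_splitFactor_mul_cptFactor`,
★ `splitFactor_flipSet`: the split factors do not see the flips), so `E_S` transforms by the SAME unit as `R_S` (★ `archRH_flipSet`). [cite: Shelstad1979, §4 p. 23] -/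
theorem expFactor_flipSet (S T : Finset W) (hT : ∀ w ∈ T, w ∉ S) (c : W → Fin 3 → ℝ) :
    (∏ w, (if w ∈ S then ((Real.exp (flipSet T c w 0) : ℝ) : ℂ) else 1 - (Circle.exp (flipSet T c w 2 - flipSet T c w 0) : ℂ))) =
      (∏ w ∈ T, -(Circle.exp (c w 0 - c w 2) : ℂ)) * ∏ w, (if w ∈ S then ((Real.exp (c w 0) : ℝ) : ℂ) else 1 - (Circle.exp (c w 2 - c w 0) : ℂ)) := by
  rw [expFactor_eq_splitFactor_mul_cptFactor S (flipSet T c), expFactor_eq_splitFactor_mul_cptFactor S c,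
    splitFactor_flipSet S hT (fun x => ((Real.exp x : ℝ) : ℂ)) c, cptFactor_flipSet S T hT c]
  ring

/-- **`R_S c · E_S (flipSet T c) = R_S (flipSet T c) · E_S c`** (both transform by the same flip unit). [cite: Shelstad1979, §4 p. 23] -/
theorem archRH_mul_expFactor_flipSet (S T : Finset W) (hT : ∀ w ∈ T, w ∉ S) (c : W → Fin 3 → ℝ) :
    archRH S c * (∏ w, (if w ∈ S then ((Real.exp (flipSet T c w 0) : ℝ) : ℂ) else 1 - (Circle.exp (flipSet T c w 2 - flipSet T c w 0) : ℂ))) =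
      archRH S (flipSet T c) * ∏ w, (if w ∈ S then ((Real.exp (c w 0) : ℝ) : ℂ) else 1 - (Circle.exp (c w 2 - c w 0) : ℂ)) := by
  rw [expFactor_flipSet S T hT c, archRH_flipSet S T hT c]
  ring

omit [Fintype W] [DecidableEq W] in
/-- The flip unit of ★ `archRH_flipSet` times `u_T c := Π_{w∈T} −e^{i(c_{w2}−c_{w0})}` is `1` (`u_T` is its inverse). [cite: Shelstad1979, §4 p. 23] -/
theorem flipUnit_mul_flipUnit_eq_one (T : Finset W) (c : W → Fin 3 → ℝ) :
    (∏ w ∈ T, -(Circle.exp (c w 0 - c w 2) : ℂ)) * (∏ w ∈ T, -(Circle.exp (c w 2 - c w 0) : ℂ)) = 1 := by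
  rw [← Finset.prod_mul_distrib]
  refine Finset.prod_eq_one fun w _ => ?_
  rw [neg_mul_neg, coe_circleExp_sub_mul_coe_circleExp_sub]

omit [Fintype W] [DecidableEq W] in
/-- The flip unit does not vanish. [cite: Shelstad1979, §4 p. 23] -/
theorem flipUnit_ne_zero (T : Finset W) (c : W → Fin 3 → ℝ) : (∏ w ∈ T, -(Circle.exp (c w 0 - c w 2) : ℂ)) ≠ 0 :=
  Finset.prod_ne_zero_iff.2 fun _ _ => neg_ne_zero.2 (Circle.coe_ne_zero _)

omit [Fintype W] [DecidableEq W] in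
/-- `u_T` is unimodular: `‖Π_{w∈T} −e^{i(c_{w2}−c_{w0})}‖ = 1`. [cite: Shelstad1979, §4 p. 23] -/
theorem norm_flipUnit_eq_one (T : Finset W) (c : W → Fin 3 → ℝ) : ‖∏ w ∈ T, -(Circle.exp (c w 2 - c w 0) : ℂ)‖ = 1 := by
  rw [norm_prod]
  exact Finset.prod_eq_one fun w _ => by rw [norm_neg, Circle.norm_coe]

omit [DecidableEq W] in
/-- `u_T` is smooth in the coordinates. [cite: Shelstad1979, §4 p. 23] -/
theorem contDiff_flipUnit (T : Finset W) : ContDiff ℝ ∞ fun c : W → Fin 3 → ℝ => ∏ w ∈ T, -(Circle.exp (c w 2 - c w 0) : ℂ) := by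
  refine contDiff_prod fun w _ => ?_
  have h : (fun c : W → Fin 3 → ℝ => -(Circle.exp (c w 2 - c w 0) : ℂ)) = fun c => -Complex.exp (((c w 2 - c w 0 : ℝ) : ℂ) * I) :=
    funext fun c => by rw [Circle.coe_exp]
  rw [h]
  exact (Complex.contDiff_exp.comp ((ofRealCLM.contDiff.comp ((contDiff_apply_apply ℝ ℝ w 2).sub (contDiff_apply_apply ℝ ℝ w 0))).mul contDiff_const)).neg

/-- **THE `T`-REDUCTION**: `E_S c · I (flipSet T c) = u_T c · (E_S · I)(flipSet T c)` with the smooth unimodular unit `u_T c = Π_{w∈T} −e^{i(c_{w2}−c_{w0})}` — the `T`-th term of the model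
of the stable family is ONE function `G₀ := E_S · I` composed with the flip, times a unit. [cite: Shelstad1979, §4 p. 23] [cite: Bouaziz1994IntegralesOrbitales, §6.2 p. 591] -/
theorem expFactor_mul_apply_flipSet (S T : Finset W) (hT : ∀ w ∈ T, w ∉ S) (I : (W → Fin 3 → ℝ) → ℂ) (c : W → Fin 3 → ℝ) :
    (∏ w, (if w ∈ S then ((Real.exp (c w 0) : ℝ) : ℂ) else 1 - (Circle.exp (c w 2 - c w 0) : ℂ))) * I (flipSet T c) =
      (∏ w ∈ T, -(Circle.exp (c w 2 - c w 0) : ℂ)) *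
        ((∏ w, (if w ∈ S then ((Real.exp (flipSet T c w 0) : ℝ) : ℂ) else 1 - (Circle.exp (flipSet T c w 2 - flipSet T c w 0) : ℂ))) * I (flipSet T c)) := by
  rw [expFactor_flipSet S T hT c]
  linear_combination (-(∏ w, (if w ∈ S then ((Real.exp (c w 0) : ℝ) : ℂ) else 1 - (Circle.exp (c w 2 - c w 0) : ℂ))) * I (flipSet T c)) *
    flipUnit_mul_flipUnit_eq_one T c

end FlipUnit

/-! ## §2 The abstract transfer: a continuous `G` on `InRegS S` that is `R_S · stableSum` on `RegS S` IS the family on `InRegS S` -/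

section Transfer

local notation3 "Φ₂[" L "]" => (Matrix.of fun i j : Fin 2 => if i.val + j.val + 1 = 2 then (1 : L) else 0)
local notation3 "Φ₁[" L "]" => (Matrix.of fun i j : Fin 1 => if i.val + j.val + 1 = 1 then (1 : L) else 0)
local notation3 "𝔸[" L "]" => ↥(arch (↥(maximalRealSubfield L)) L (IsCMField.complexConj L) 2 Φ₂[L])
local notation3 "𝔹[" L "]" => ↥(arch (↥(maximalRealSubfield L)) L (IsCMField.complexConj L) 1 Φ₁[L])

variable (L : Type) [Field L] [NumberField L] [IsCMField L]
  [MeasurableSpace (𝔸[L] × 𝔹[L])] [BorelSpace (𝔸[L] × 𝔹[L])]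
  (νH : Measure (𝔸[L] × 𝔹[L])) [IsFiniteMeasureOnCompacts νH] [νH.IsMulRightInvariant]
  (fH : 𝔸[L] × 𝔹[L] → ℂ) (S : Finset {w : InfinitePlace L // IsComplex w})

/-- **THE ABSTRACT TRANSFER** (any `fH`, any `νH`; no smoothness): if `G` is continuous on `InRegS S` and `R_S(c) · stableSum S (chartOrbH νH S fH) c = G c` for every `c ∈ RegS S`, then
`stOrbFamH L νH fH S c = G c` for EVERY `c ∈ InRegS S`.  On `RegS S` this is the literal reading (★ `stOrbFamH_of_mem_regS`); at a real-wall point `c ∈ InRegS S ∖ RegS S` the family is by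
definition the limit of `R_S · stableSum` from `RegS S` (★ `stOrbFamH_eq_of_tendsto`; `c ∈ closure (RegS S)` by ★ `mem_closure_regS`), and that limit is `G c` because `G` is continuous
within `InRegS S ⊇ RegS S`.  (Harish-Chandra ∕ Varadarajan: `F_f` is determined on `T_{in-reg}` by its values on the regular set.) [cite: Varadarajan1989, §6.4 Thm 22]
[cite: Bouaziz1994IntegralesOrbitales, §6.2 p. 591] -/
theorem stOrbFamH_eq_of_continuousOn_of_eqOn_regS {G : ({w : InfinitePlace L // IsComplex w} → Fin 3 → ℝ) → ℂ} (hG : ContinuousOn G (InRegS S))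
    (heq : ∀ c ∈ RegS S, archRH S c * stableSum S (chartOrbH L νH S fH) c = G c) :
    ∀ c ∈ InRegS S, stOrbFamH L νH fH S c = G c := by
  intro c hc
  by_cases hcR : c ∈ RegS S
  · rw [stOrbFamH_of_mem_regS L νH fH S hcR, ← heq c hcR, stableSum_def]
  · refine stOrbFamH_eq_of_tendsto L νH fH S hc hcR (mem_closure_regS S c) ?_
    have h1 : Tendsto G (𝓝[RegS S] c) (𝓝 (G c)) := (hG c hc).tendsto.mono_left (nhdsWithin_mono c (regS_subset_inRegS S))
    refine h1.congr' ?_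
    filter_upwards [self_mem_nhdsWithin] with c' hc'
    exact (heq c' hc').symm

/-- `EqOn` dress of ★ `stOrbFamH_eq_of_continuousOn_of_eqOn_regS`. [cite: Varadarajan1989, §6.4 Thm 22] -/
theorem stOrbFamH_eqOn_of_continuousOn_of_eqOn_regS {G : ({w : InfinitePlace L // IsComplex w} → Fin 3 → ℝ) → ℂ} (hG : ContinuousOn G (InRegS S))
    (heq : ∀ c ∈ RegS S, archRH S c * stableSum S (chartOrbH L νH S fH) c = G c) :
    EqOn (stOrbFamH L νH fH S) G (InRegS S) :=
  fun c hc => stOrbFamH_eq_of_continuousOn_of_eqOn_regS L νH fH S hG heq c hc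

/-- **JETS**: under the same hypotheses the family and `G` have the same iterated Fréchet derivatives at every point of the OPEN set `InRegS S` (they agree on a neighbourhood).
[cite: Varadarajan1989, §6.4 Thm 23] -/
theorem iteratedFDeriv_stOrbFamH_eq_of_eqOn_regS {G : ({w : InfinitePlace L // IsComplex w} → Fin 3 → ℝ) → ℂ} (hG : ContinuousOn G (InRegS S))
    (heq : ∀ c ∈ RegS S, archRH S c * stableSum S (chartOrbH L νH S fH) c = G c)
    {c : {w : InfinitePlace L // IsComplex w} → Fin 3 → ℝ} (hc : c ∈ InRegS S) (n : ℕ) :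
    iteratedFDeriv ℝ n (stOrbFamH L νH fH S) c = iteratedFDeriv ℝ n G c := by
  have h : stOrbFamH L νH fH S =ᶠ[𝓝 c] G :=
    (stOrbFamH_eqOn_of_continuousOn_of_eqOn_regS L νH fH S hG heq).eventuallyEq_of_mem ((isOpen_inRegS S).mem_nhds hc)
  exact (h.iteratedFDeriv ℝ n).eq_of_nhds

/-! ## §3 The stable sum of a model: the compact factors cancel at every flip -/

/-- **THE STABLE SUM OF A MODEL**: if `R_S(c) · chartOrbH νH S fH c = K₀ · E_S(c) · I(c)` for every `c ∈ RegS S` (a MODEL `(K₀, I)`: ★ (M1b′) single leaf, or ★ (α4¹) p850894 with a set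
of compact places integrated out first), then for every `c ∈ RegS S`
`R_S(c) · stableSum S (chartOrbH νH S fH) c = K₀ · E_S(c) · Σ_{T ⊆ univ∖S} I (flipSet T c)` — apply the model at `flipSet T c ∈ RegS S` (★ `flipSet_mem_regS_iff`) and cancel the common flip
unit of `R_S` and `E_S` (★ `archRH_flipSet`, ★ `expFactor_flipSet`).  (★ [C1b]'s step (M3), for an abstract `I`.) [cite: Shelstad1979, §4 pp. 22–23] [cite: Rogawski1990, §4.1 (4.1.1) p. 39] -/
theorem archRH_mul_stableSum_chartOrbH_eq_of_model {K₀ : ℂ} {I : ({w : InfinitePlace L // IsComplex w} → Fin 3 → ℝ) → ℂ}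
    (hid : ∀ c ∈ RegS S, archRH S c * chartOrbH L νH S fH c =
      K₀ * (∏ w, (if w ∈ S then ((Real.exp (c w 0) : ℝ) : ℂ) else 1 - (Circle.exp (c w 2 - c w 0) : ℂ))) * I c) :
    ∀ c ∈ RegS S, archRH S c * stableSum S (chartOrbH L νH S fH) c =
      K₀ * (∏ w, (if w ∈ S then ((Real.exp (c w 0) : ℝ) : ℂ) else 1 - (Circle.exp (c w 2 - c w 0) : ℂ))) *
        ∑ T ∈ (Finset.univ \ S).powerset, I (flipSet T c) := by
  intro c hc
  rw [stableSum_def, Finset.mul_sum, Finset.mul_sum]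
  refine Finset.sum_congr rfl fun T hT => ?_
  have hTS : ∀ w ∈ T, w ∉ S := not_mem_of_mem_powerset_sdiff hT
  have hcT : flipSet T c ∈ RegS S := (flipSet_mem_regS_iff S hTS c).2 hc
  have h := hid (flipSet T c) hcT
  rw [archRH_flipSet S T hTS c, expFactor_flipSet S T hTS c] at h
  apply mul_left_cancel₀ (flipUnit_ne_zero T c)
  linear_combination h

/-! ## §4 The head: the family IS the model on `InRegS S`; smoothness and jets of the model; the flip-unit form -/

omit [IsCMField L] [MeasurableSpace (𝔸[L] × 𝔹[L])] [BorelSpace (𝔸[L] × 𝔹[L])] in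
/-- **The model is continuous on `InRegS S` when `I` is** (`E_S` is smooth, ★ `contDiff_expFactor`; the flips are continuous and preserve `InRegS S`, ★ `continuous_flipSet`, ★
`flipSet_mem_inRegS_iff`). [cite: Bouaziz1994IntegralesOrbitales, §6.2 p. 591] -/
theorem continuousOn_model_inRegS (K₀ : ℂ) {I : ({w : InfinitePlace L // IsComplex w} → Fin 3 → ℝ) → ℂ} (hI : ContinuousOn I (InRegS S)) :
    ContinuousOn (fun c : {w : InfinitePlace L // IsComplex w} → Fin 3 → ℝ =>
      K₀ * (∏ w, (if w ∈ S then ((Real.exp (c w 0) : ℝ) : ℂ) else 1 - (Circle.exp (c w 2 - c w 0) : ℂ))) *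
        ∑ T ∈ (Finset.univ \ S).powerset, I (flipSet T c)) (InRegS S) := by
  refine (continuousOn_const.mul (contDiff_expFactor S).continuous.continuousOn).mul (continuousOn_finsetSum _ fun T _ => ?_)
  exact hI.comp (continuous_flipSet T).continuousOn fun c hc => (flipSet_mem_inRegS_iff S T c).2 hc

omit [IsCMField L] [MeasurableSpace (𝔸[L] × 𝔹[L])] [BorelSpace (𝔸[L] × 𝔹[L])] in
/-- **The model is `C^∞` on `InRegS S` when `I` is** (as in ★ [C1b]). [cite: Varadarajan1989, §6.4 Thm 23] -/
theorem contDiffOn_model_inRegS (K₀ : ℂ) {I : ({w : InfinitePlace L // IsComplex w} → Fin 3 → ℝ) → ℂ} (hI : ContDiffOn ℝ ∞ I (InRegS S)) :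
    ContDiffOn ℝ ∞ (fun c : {w : InfinitePlace L // IsComplex w} → Fin 3 → ℝ =>
      K₀ * (∏ w, (if w ∈ S then ((Real.exp (c w 0) : ℝ) : ℂ) else 1 - (Circle.exp (c w 2 - c w 0) : ℂ))) *
        ∑ T ∈ (Finset.univ \ S).powerset, I (flipSet T c)) (InRegS S) := by
  refine (contDiffOn_const.mul (contDiff_expFactor S).contDiffOn).mul (ContDiffOn.sum fun T _ => ?_)
  exact hI.comp (contDiff_flipSet T).contDiffOn fun c hc => (flipSet_mem_inRegS_iff S T c).2 hc

/-- **HEAD — THE MODEL IDENTITY ON `InRegS S`**: for ANY model `(K₀, I)` of `R_S · chartOrbH νH S fH` on `RegS S` with `I` continuous on `InRegS S`, and every `c ∈ InRegS S`,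
`stOrbFamH L νH fH S c = K₀ · E_S(c) · Σ_{T ⊆ univ∖S} I (flipSet T c)` — on `RegS S` by §3, on the real walls because both sides are continuous on the open `InRegS S` in which `RegS S`
is dense (§2; the family's continuity there is built into its definition, ★ `stOrbFamH_eq_of_tendsto`).  (The design's (S7) «`stOrbFamH = K₀·E_S·Σ_T I∘flipSet T` on `InRegS`»; for
`fH ∈ C_c^∞` and the single-leaf model this is the identity inside ★ [C1b], now exported for every model.) [cite: Varadarajan1989, §6.4 Thm 22–23] [cite: Shelstad1979, §4 pp. 22–25]
[cite: Bouaziz1994IntegralesOrbitales, §6.2 p. 591] -/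
theorem stOrbFamH_eq_model_of_mem_inRegS {K₀ : ℂ} {I : ({w : InfinitePlace L // IsComplex w} → Fin 3 → ℝ) → ℂ}
    (hid : ∀ c ∈ RegS S, archRH S c * chartOrbH L νH S fH c =
      K₀ * (∏ w, (if w ∈ S then ((Real.exp (c w 0) : ℝ) : ℂ) else 1 - (Circle.exp (c w 2 - c w 0) : ℂ))) * I c)
    (hI : ContinuousOn I (InRegS S)) :
    ∀ c ∈ InRegS S, stOrbFamH L νH fH S c =
      K₀ * (∏ w, (if w ∈ S then ((Real.exp (c w 0) : ℝ) : ℂ) else 1 - (Circle.exp (c w 2 - c w 0) : ℂ))) *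
        ∑ T ∈ (Finset.univ \ S).powerset, I (flipSet T c) :=
  stOrbFamH_eq_of_continuousOn_of_eqOn_regS L νH fH S (continuousOn_model_inRegS L S K₀ hI)
    (archRH_mul_stableSum_chartOrbH_eq_of_model L νH fH S hid)

/-- **JETS OF THE FAMILY = JETS OF THE MODEL on `InRegS S`** (for `I` smooth on `InRegS S`; what (S5)∕(S7) bound). [cite: Varadarajan1989, §6.4 Thm 23] -/
theorem iteratedFDeriv_stOrbFamH_eq_model {K₀ : ℂ} {I : ({w : InfinitePlace L // IsComplex w} → Fin 3 → ℝ) → ℂ}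
    (hid : ∀ c ∈ RegS S, archRH S c * chartOrbH L νH S fH c =
      K₀ * (∏ w, (if w ∈ S then ((Real.exp (c w 0) : ℝ) : ℂ) else 1 - (Circle.exp (c w 2 - c w 0) : ℂ))) * I c)
    (hI : ContDiffOn ℝ ∞ I (InRegS S)) {c : {w : InfinitePlace L // IsComplex w} → Fin 3 → ℝ} (hc : c ∈ InRegS S) (n : ℕ) :
    iteratedFDeriv ℝ n (stOrbFamH L νH fH S) c =
      iteratedFDeriv ℝ n (fun c : {w : InfinitePlace L // IsComplex w} → Fin 3 → ℝ =>
        K₀ * (∏ w, (if w ∈ S then ((Real.exp (c w 0) : ℝ) : ℂ) else 1 - (Circle.exp (c w 2 - c w 0) : ℂ))) *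
          ∑ T ∈ (Finset.univ \ S).powerset, I (flipSet T c)) c :=
  iteratedFDeriv_stOrbFamH_eq_of_eqOn_regS L νH fH S (continuousOn_model_inRegS L S K₀ hI.continuousOn)
    (archRH_mul_stableSum_chartOrbH_eq_of_model L νH fH S hid) hc n

/-- **THE FLIP-UNIT FORM** ((S7) `T`-reduction applied termwise): for every `c ∈ InRegS S`,
`stOrbFamH L νH fH S c = K₀ · Σ_{T ⊆ univ∖S} u_T(c) · (E_S · I)(flipSet T c)`, `u_T c = Π_{w∈T} −e^{i(c_{w2}−c_{w0})}` (smooth, unimodular: ★ `contDiff_flipUnit`, ★ `norm_flipUnit_eq_one`) — the stable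
family is a sum of the `2^{#compact places}` flips of ONE function `G₀ := E_S · I`, times units. [cite: Shelstad1979, §4 pp. 22–25] [cite: Bouaziz1994IntegralesOrbitales, §6.2 p. 591] -/
theorem stOrbFamH_eq_sum_flipUnit_mul_model_flipSet {K₀ : ℂ} {I : ({w : InfinitePlace L // IsComplex w} → Fin 3 → ℝ) → ℂ}
    (hid : ∀ c ∈ RegS S, archRH S c * chartOrbH L νH S fH c =
      K₀ * (∏ w, (if w ∈ S then ((Real.exp (c w 0) : ℝ) : ℂ) else 1 - (Circle.exp (c w 2 - c w 0) : ℂ))) * I c)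
    (hI : ContinuousOn I (InRegS S)) :
    ∀ c ∈ InRegS S, stOrbFamH L νH fH S c =
      K₀ * ∑ T ∈ (Finset.univ \ S).powerset, (∏ w ∈ T, -(Circle.exp (c w 2 - c w 0) : ℂ)) *
        ((∏ w, (if w ∈ S then ((Real.exp (flipSet T c w 0) : ℝ) : ℂ) else 1 - (Circle.exp (flipSet T c w 2 - flipSet T c w 0) : ℂ))) * I (flipSet T c)) := by
  intro c hc
  rw [stOrbFamH_eq_model_of_mem_inRegS L νH fH S hid hI c hc, mul_assoc K₀, Finset.mul_sum]
  exact congrArg (fun x => K₀ * x) (Finset.sum_congr rfl fun T hT => expFactor_mul_apply_flipSet S T (not_mem_of_mem_powerset_sdiff hT) I c)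

end Transfer

end Literature.NumberTheory.Rogawski1990

end
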